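import Literature.Probability.Percolation.ContinuityCriterion
import Literature.Probability.Percolation.ConnectivityThetaSqProofs
import Literature.Probability.Percolation.DiscontinuityImpliesGammaTwo
import Literature.Probability.Percolation.HalfSpaceProofs
import Literature.Probability.Percolation.KozmaNitzanTheorem6Split
import Literature.Barriers.CriticalPhenomena.SameDensityLocalUniqueness
import Literature.Barriers.CriticalPhenomena.SprinklingRenormalisation
import HarnessLib

/-!
# The jump world of `PercolationContinuityZ3` and its doors

`jumpWorld_portrait`: the certified consequences of `¬ PercolationContinuityZ3`
(`θ₀ := θ(p_c(ℤ³)) > 0`), assembled from the tree — long-range order `τ_{p_c} ≥ θ₀²`,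
persistence of two-arm events at every large scale, no half-space percolation at `p_c`,
existence of a percolating `p` with no slab percolation at that `p`, `γ ≥ 2` in the form
`θ₀ ≤ K (p_c - p)² χ(p)`, and failure of Kozma–Nitzan's Conjecture 3. A proof of the conjunct is
exactly a contradiction with this list (solo seat `solo-CriticalPhenomena-informed`, census
`paper/sharpest-statement.md` §2).

`percolationContinuityZ3_of_doors`: the disjunction of the six sufficient inputs ("doors") known
to the tree, each closing the conjunct — useful as the single entry point for any future input.
-/

noncomputable section

namespace Summit.CriticalPhenomena.PercolationContinuityZ3.Theorems

open MeasureTheory Filter Topology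
open Literature.Probability.Percolation Literature.Probability.LatticeModels
open Literature.Barriers.CriticalPhenomena

/-- `¬ PercolationContinuityZ3` means `θ(p_c) > 0` on `ℤ³`. -/
theorem theta_criticalProbI_pos_of_not (h : ¬ PercolationContinuityZ3) :
    0 < theta (zdGraph 3) (0 : Site 3) (criticalProbI 3) := by
  have hne : theta (zdGraph 3) (0 : Site 3) (criticalProbI 3) ≠ 0 := fun h0 =>
    h (percolationContinuityZ3_iff.mpr h0)
  exact lt_of_le_of_ne measureReal_nonneg (Ne.symm hne)

/-- **Portrait of the jump world.** If `θ(p_c(ℤ³)) > 0` then, at `p = p_c`: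
(1) `θ₀ > 0`; (2) long-range order `θ₀² ≤ τ_{p_c}(0,x)` for all `x`, so (3) `τ_{p_c}(0,·) ↛ 0`;
(4) two-arm events persist with probability `≥ ε` at every large scale; (5) the half-space does
not percolate at `p_c` (Barsky–Grimmett–Newman); (6) some percolating `p` has no percolating slab
at the same `p`; (7) `θ₀ ≤ K₃ (p_c − p)² χ(p)` for every `0 < p < p_c` (`γ ≥ 2`);
(8) Kozma–Nitzan's Conjecture 3 fails. -/
theorem jumpWorld_portrait (h : ¬ PercolationContinuityZ3) :
    0 < theta (zdGraph 3) (0 : Site 3) (criticalProbI 3) ∧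
    (∀ x : Site 3, theta (zdGraph 3) (0 : Site 3) (criticalProbI 3) ^ 2 ≤
      tau 3 (criticalProbI 3) 0 x) ∧
    ¬ Tendsto (tau 3 (criticalProbI 3) 0) cofinite (𝓝 0) ∧
    (∃ ε : ℝ, 0 < ε ∧ ∃ N₁ : ℕ, ∀ N₀ : ℕ, N₁ ≤ N₀ →
      ε ≤ (bondPercolation (zdGraph 3) (criticalProbI 3)).real
        (KestenZhang.TwoArms (d := 3) N₀)) ∧
    theta ((zdGraph 3).induce {x | 0 ≤ x 0}) ⟨0, Set.mem_setOf.mpr le_rfl⟩ (criticalProbI 3)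
      = 0 ∧
    (∃ p : unitInterval, 0 < theta (zdGraph 3) (0 : Site 3) p ∧
      ∀ k : ℕ, 0 < k → theta (slabGraph 3 k) (slabOrigin 3 k) p = 0) ∧
    (∀ p : unitInterval, 0 < (p : ℝ) → (p : ℝ) < criticalProb (zdGraph 3) (0 : Site 3) →
      theta (zdGraph 3) (0 : Site 3) (criticalProbI 3) ≤
        16 * (3 : ℕ) / (criticalProb (zdGraph 3) (0 : Site 3) *
            (1 - criticalProb (zdGraph 3) (0 : Site 3))) *
          (criticalProb (zdGraph 3) (0 : Site 3) - p) ^ 2 * chi 3 p) ∧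
    ¬ KozmaNitzan2024_conjecture3 := by
  have hpos := theta_criticalProbI_pos_of_not h
  have hnc : ¬ PercolationContinuity 3 := h
  refine ⟨hpos, fun x => Grimmett1999_theta_sq_le_openConn_holds 3 (criticalProbI 3) 0 x, ?_,
    SameDensityLocalUniqueness_holds 3 (by norm_num) hpos, BarskyGrimmettNewman1991_Z3_holds,
    ?_, fun p hp0 hp => theta_criticalProbI_le_sq_mul_chi (d := 3) (by norm_num) p hp0 hp, ?_⟩
  · exact fun ht => hnc
      ((Literature.Probability.Percolation.percolationContinuity_iff_tendsto_tau (d := 3)).mpr ht)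
  · by_contra hall
    push Not at hall
    apply hnc
    refine percolationContinuity_of_samePSlab DuminilCopinSidoraviciusTassion2016_holds ?_
    intro p hp
    obtain ⟨k, hk, hne⟩ := hall p hp
    exact ⟨k, hk, lt_of_le_of_ne measureReal_nonneg (Ne.symm hne)⟩
  · exact fun hC => hnc
      (percolationContinuityZ3_of_slabPercolation KozmaNitzan2024_slabPercolation_holds hC)

/-- **The doors.** Each of the following inputs proves `PercolationContinuityZ3`:
(a) decay of the critical two-point function along the cofinite filter;
(b) local uniqueness (two-arm events become rare) at every percolating `p`;
(c) same-`p` slab transfer; (d) same-`p` half-space transfer;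
(e) `liminf_{p ↑ p_c} (p_c − p)² χ(p) = 0` (`γ < 2` along a sequence);
(f) Kozma–Nitzan's Conjecture 3. -/
theorem percolationContinuityZ3_of_doors
    (h : Tendsto (tau 3 (criticalProbI 3) 0) cofinite (𝓝 0) ∨
      (∀ p : unitInterval, 0 < theta (zdGraph 3) (0 : Site 3) p →
        ∀ ε : ℝ, 0 < ε → ∃ N₁ : ℕ, ∀ N₀ : ℕ, N₁ ≤ N₀ →
          (bondPercolation (zdGraph 3) p).real (KestenZhang.TwoArms (d := 3) N₀) ≤ ε) ∨
      (∀ p : unitInterval, 0 < theta (zdGraph 3) (0 : Site 3) p →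
        ∃ k : ℕ, 0 < k ∧ 0 < theta (slabGraph 3 k) (slabOrigin 3 k) p) ∨
      (∀ p : unitInterval, 0 < theta (zdGraph 3) (0 : Site 3) p →
        0 < theta ((zdGraph 3).induce {x | 0 ≤ x 0}) ⟨0, Set.mem_setOf.mpr le_rfl⟩ p) ∨
      (∀ ε : ℝ, 0 < ε → ∃ p : unitInterval, 0 < (p : ℝ) ∧
        (p : ℝ) < criticalProb (zdGraph 3) (0 : Site 3) ∧
        (criticalProb (zdGraph 3) (0 : Site 3) - p) ^ 2 * chi 3 p < ε) ∨
      KozmaNitzan2024_conjecture3) :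
    PercolationContinuityZ3 := by
  rcases h with ha | hb | hc | hd | he | hf
  · exact
      (Literature.Probability.Percolation.percolationContinuity_iff_tendsto_tau (d := 3)).mpr ha
  · exact twoArmsSmallOfTheta_iff_percolationContinuityZ3.mp hb
  · exact percolationContinuity_of_samePSlab DuminilCopinSidoraviciusTassion2016_holds hc
  · by_contra hnot
    have hpos := theta_criticalProbI_pos_of_not hnot
    have hH := hd (criticalProbI 3) hpos
    rw [BarskyGrimmettNewman1991_Z3_holds] at hH
    exact lt_irrefl 0 hH
  · exact percolationContinuity_of_sq_mul_chi_small (d := 3) (by norm_num) he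
  · exact percolationContinuityZ3_of_slabPercolation KozmaNitzan2024_slabPercolation_holds hf

end Summit.CriticalPhenomena.PercolationContinuityZ3.Theorems
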